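import Summits.ResolutionOfSingularities.ResolutionOfSingularities.Theorems.DepthLaw
import Literature.AlgebraicGeometry.Resolution.PointBlowupMohBound
import HarnessLib

/-!
# AntelopeDictionary — decomp-res node «AntelopeCut» (lens-4 g27, critic row 157), tree file 3/5 of the node

Content VERBATIM from the decomp-res lens-4 g27 node `HOME/decomp-res-lens-4/g27/AntelopeCut.lean` (pin de2834f0 =
`parts/AntelopeCut-g27-de2834f0.lean`,
1 885 l; HOME = run/shared/lean/pub/decomp-res): its NEW PART ONLY, §71–§73 = `parts/part_new-g27-7bf105d9.lean` (40
declarations) — the carried block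
l. 106–1279 (= g26/CompanionCut.lean ll. 85–1258 VERBATIM, machine diff empty) is ALREADY in the tree as
`Theorems/CompanionAlgebra` · `CompanionHasse` ·
`CompanionPresentation` · `CompanionTransport` · `CompanionTowers` · `CompanionCutCells` ·
`MaxContactCutCompanionCut` and is imported, not repeated.
Critic: CRITIC-LEDGER row 157 (2026-08-31T00:29:39Z): DECIDED 0 · MAP 0 — BOOKED («true kernel bricks — land as
support»; the depth / height /
dimension-count axis was priced once at row 151).  Landing orders INBOX :558/:560 (lens-4 g27 landing note +
erratum, split per NEXT-g28 §4) and :566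
(critic): `--kind proof --supports stmt-ResolutionOfSingularities-28338`, namespace `…Theorems.HugValuationCut`,
canonical headers; files of the node:
`DepthLawAlgebra` · `DepthLaw` (§71 + §71b) · `AntelopeDictionary` (§72) · `DepthCutCells` (§73, cone-free cells) ·
`MaxContactCutDepthCut` (the four §73 corollaries GIVEN
31571 `MaxContactCut.NoContactHuggingTowers` BY NAME — in the Theses cone).  Aside bookkeeping (row 157 / INBOX
:566): ONE successor aside on the lens-4
column, `NoWildShallowCompanionKangarooTowers` (home `DepthCutCells`), SUPERSEDING g26's
`NoWildCompanionKangarooTowers` / g25's route aside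
`HCNoWildKangarooOffDoublePointTowers` (exact hyp-free `noWildCompanionKangarooTowers_iff_g27`); the decided cell
`NoWildDeepCompanionKangarooTowers` is a
THEOREM (`noWildDeepCompanionKangarooTowers_holds`) and is not filed; `HeightLaw.no_doublePointTower` stays.

## This file

§72 (NEW, PROVED in the tree's polynomial model `Literature/…/PointBlowupShade|MohBound`): THE ANTELOPE LAW —
`section ShadeDictionary`: `isEquimultiplePoint_of_two_mul_le` (K1: depth `N ≥ 2p` ⟹ every point of every
exceptional chart is equimultiple), `two_mul_le_of_shadeIncreases` (Hauser's Kangaroo condition (1) + `p`-power form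
⟹ an antelope has depth `≥ 2p`), `isEquimultiplePoint_of_shadeIncreases` («kangaroo points are never isolated points
of the weight-`p` locus»), `shade_step_le_of_depth_window` (in the forced window `p + 1 ≤ N ≤ 2p − 1` the shade is
non-increasing at every point of every chart).  Header `variable (p : ℕ) [hp : Fact p.Prime] … [CharP K p]` with ONE
`omit hp [CharP K p] in` exactly as in the lens.  Imports `DepthLaw` (the window arithmetic) + `Literature…PointBlowupMohBound`.

[WRITER NOTE (decomp-res writer g9): file split only (tree files ≤ 400 lines); namespace, universe, sections,
section variables and every declaration
exactly as in the lens (the node's global `set_option` and the `open …Theses` line live only in the wiring file).]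

(Sources: Hauser2010Kangaroo (arXiv:0811.4151 §C); Moh1987; HauserPerlega2019 §1; Hauser2024 PRIMS 60 pp. 788, 798;
Cossart2011 III.2 (doi:10.4310/ajm.2011.v15.n3.a3); CossartPiltant2008 §2; CossartPiltant2019 Prop. 2.50;
Giraud1975; Hironaka1970Additive.)
-/

noncomputable section

open CategoryTheory AlgebraicGeometry IsLocalRing
open Literature.AlgebraicGeometry.Resolution
open Summit.ResolutionOfSingularities.ResolutionOfSingularities.Theorems
open WeakOrderReduction ForcedTowerClasses DivergentTowerClasses MonomialTowerClasses
open HugDimensionClasses HugDimensionKernels SurfaceShadowClasses SurfaceShadowKernels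
open NearPointCut (SingularClass)
open AbsoluteContactClasses (IsAbsContactAt SepResidueAt diffIdeal_restrict_le stalkMap_comp_toStalk_eq_stalkHom)
open scoped BigOperators

namespace Summit.ResolutionOfSingularities.ResolutionOfSingularities.Theorems.HugValuationCut

section ShadeDictionary

open MvPolynomial
variable {σ : Type*} {K : Type*} [Field K] [Fintype σ] [DecidableEq σ] [DecidableEq K]

/-! ## §72 (g27 · NEW · MODEL, PROVED) THE ANTELOPE DICTIONARY — Hauser's kangaroo arithmetic meets the depth threshold `2p`

In the tree's polynomial model of point blow-ups of `x^q + F(y)` (`Literature/AlgebraicGeometry/Resolution/PointBlowupShade`,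
`…MohBound`: states `(F, r)`, `ord₀ F = |r| + shade` = THE DEPTH of the contact `x`), three facts:
(K1) `isEquimultiplePoint_of_two_mul_le`: if `ord₀ F ≥ 2q` then EVERY point `b` of EVERY exceptional chart `y_j` (`b_j = 0`) is
  an EQUIMULTIPLE point — the whole exceptional hyperplane of the contact hypersurface lies in the top locus of the transform
  (the model face of LAW A: the successor is never isolated when `dim ≥ 3`);
(K2) `two_mul_le_of_shadeIncreases`: in the `p`-power class (`F` clean, `ord₀ F ≥ p + 1`, `y^r ∣ F`) a SHADE INCREASE at the
  blow-up (antelope → kangaroo) forces `ord₀ F ≥ 2p` — Hauser's Kangaroo Theorem condition (1) `p ∣ |r| + shade` (tree: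
  `PointBlowup.necessary_of_shadeIncreases`, arXiv:0811.4151 §C; Moh1987) plus `not_dvd_of_depth_window`;
(K3) `isEquimultiplePoint_of_shadeIncreases`: hence above an ANTELOPE every point of every exceptional chart is equimultiple —
  «KANGAROO POINTS ARE NEVER ISOLATED»; a forced (isolated-point) tower never meets one: its shade is non-increasing. -/

/-- **(K1) DEPTH ≥ 2q ⇒ EVERY EXCEPTIONAL POINT IS EQUIMULTIPLE (MODEL, PROVED).**  For a state `s = (F, r)` of the
point-blow-up
model of `x^q + F(y)` with `ord₀ F ≥ 2q`, every point `b` of the exceptional hyperplane of the `y_j`-chart (`b_j = 0`) is an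
equimultiple point: every monomial of the translated chart transform keeps `y_j`-degree `|d| − q ≥ q`. [folklore] -/
theorem isEquimultiplePoint_of_two_mul_le (q : ℕ) (j : σ) (b : σ → K) (hbj : b j = 0) (s : PointBlowup.State σ K)
    (h2q : ((2 * q : ℕ) : ℕ∞) ≤ Hauser2010.ordZero s.F) : PointBlowup.IsEquimultiplePoint q j b s := by
  classical
  intro d hd0 hdq
  by_contra hne
  have hmem : coeff d (PointBlowup.pointTransform q j b s) ≠ 0 := hne
  rw [PointBlowup.pointTransform_eq_sum, coeff_sum] at hmem
  obtain ⟨e, he, hcoeff⟩ := Finset.exists_ne_zero_of_sum_ne_zero hmem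
  have hdj : d j = PointBlowup.chartExponent q j e j :=
    PointBlowup.apply_eq_of_coeff_translate_monomial_ne_zero b hbj hcoeff
  rw [PointBlowup.chartExponent_apply, if_pos rfl] at hdj
  have h1 : 2 * q ≤ e.degree := by
    have := h2q.trans (Literature.Barriers.ResolutionOfSingularities.ordZero_le_of_coeff_ne_zero _ _
      (MvPolynomial.mem_support_iff.mp he))
    exact_mod_cast this
  have h2 : d j ≤ d.degree := Finsupp.le_degree j d
  omega

variable (p : ℕ) [hp : Fact p.Prime] [CharP K p]

/-- **(K2) AN ANTELOPE IS DEEP (MODEL, PROVED)**: in the `p`-power class (`F` clean of `p`-th powers, `ord₀ F = o ≥ p + 1`,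
`y^r ∣ F`), a shade increase at the point `b` of the `y_j`-chart forces `2p ≤ o` — Hauser's condition (1) `p ∣ o` (the tree's
`PointBlowup.necessary_of_shadeIncreases`) and the window arithmetic. (Sources: Hauser2010Kangaroo §C Kangaroo Theorem (1);
Moh1987.) -/
theorem two_mul_le_of_shadeIncreases (j : σ) (b : σ → K) (hbj : b j = 0) (s : PointBlowup.State σ K)
    (hclean : Hauser2010.deletePthPowers p s.F = s.F) {o : ℕ} (ho : Hauser2010.ordZero s.F = o) (hpo : p + 1 ≤ o)
    (hr : ∀ d ∈ s.F.support, s.r ≤ d) (hinc : PointBlowup.ShadeIncreases p j b s) : 2 * p ≤ o := by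
  obtain ⟨hdvd, -, -⟩ := PointBlowup.necessary_of_shadeIncreases p j b hbj s hclean ho (by omega) hr hinc
  exact two_mul_le_of_dvd_of_succ_le hpo hdvd

/-- **(K3) «KANGAROO POINTS ARE NEVER ISOLATED» (MODEL, PROVED)**: above an antelope state of the `p`-power class (a shade
increase happens at some point of some chart), EVERY point `b'` of EVERY exceptional chart `y_{j'}` is an equimultiple point —
the top locus of the transform contains the whole exceptional hyperplane of the contact hypersurface. (Sources:
Hauser2010Kangaroo §C; HauserPerlega2019 §1 «We were not able to construct examples with cycles where the choice of
point centers
is forced».) -/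
theorem isEquimultiplePoint_of_shadeIncreases (j : σ) (b : σ → K) (hbj : b j = 0) (s : PointBlowup.State σ K)
    (hclean : Hauser2010.deletePthPowers p s.F = s.F) {o : ℕ} (ho : Hauser2010.ordZero s.F = o) (hpo : p + 1 ≤ o)
    (hr : ∀ d ∈ s.F.support, s.r ≤ d) (hinc : PointBlowup.ShadeIncreases p j b s)
    (j' : σ) (b' : σ → K) (hb'j' : b' j' = 0) : PointBlowup.IsEquimultiplePoint p j' b' s :=
  isEquimultiplePoint_of_two_mul_le p j' b' hb'j' s
    (by rw [ho]; exact_mod_cast two_mul_le_of_shadeIncreases p j b hbj s hclean ho hpo hr hinc)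

omit hp [CharP K p] in
/-- **THE SHADE IS NON-INCREASING IN THE FORCED WINDOW (MODEL, PROVED)**: a clean state of the `p`-power class whose
depth lies in
the forced-tower window `p + 1 ≤ ord₀ F ≤ 2p − 1` (§71: the only depths before a successor of ring dimension ≥ 3)
admits NO shade
increase at ANY point of ANY exceptional chart. (Sources: Hauser2010Kangaroo §C (1); Moh1987; tree
`shade_step_le_of_not_dvd`.) -/
theorem shade_step_le_of_depth_window (j : σ) (b : σ → K) (hbj : b j = 0) (s : PointBlowup.State σ K)
    {o : ℕ} (ho : Hauser2010.ordZero s.F = o) (hpo : p + 1 ≤ o) (ho2 : o + 1 ≤ 2 * p)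
    (hr : ∀ d ∈ s.F.support, s.r ≤ d) : (PointBlowup.step p j b s).shade ≤ s.shade :=
  PointBlowup.shade_step_le_of_not_dvd p j b hbj s ho (by omega) hr (not_dvd_of_depth_window hpo ho2)

end ShadeDictionary

end Summit.ResolutionOfSingularities.ResolutionOfSingularities.Theorems.HugValuationCut
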